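import Mathlib
import HarnessLib
import Summits.HubbardSuperconductivity.HubbardSuperconductivity.Theorems.KLProgrammeC4aCoMovingJetsL1

/-!
# Route `KLProgramme` — crux C4a, (L3) interface «SUP-OUTSIDE»: the tube tadpole-jet theorem with CO-MOVING DOMINATORS THAT MAY DEPEND ON THE BASE
# ANGLE θ (`CoMovingJetsL1Theta`) — the form the umklapp caustics of the bubble force at order ≥ 1

Cell `gate-hubbard-kl`, seat hubbard-kl-k3c3-p3 (g28; row «implicit-function / monotonicity route for μ(n)»).  Located brick for the (C)-closer lane hubbard-kl-c4a-1 /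
p1b (stub (C) `stub_twoLeg_curvature` of `KLRegimeEngineV17F2`, stmt-HubbardSuperconductivity-20437), memo HOME/hubbard-kl-k3c3-p3/U1-CAUSTIC-SUP.md §2 (F1).

WHY.  `CoMovingJetsL1 N a r μ K V` (…C4aCoMovingJetsL1) asks for dominators `a_i(ρ,ϑ)` of the co-moving jets UNIFORM in the base angle `θ`.  For the particle–particle
(and particle–hole) bubble piece of the fat vertex this cannot be met with `n`-free `∫dϑ a_i` at order `i ≥ 1`: along the θ-orbit of a fixed `(ρ,ϑ)` the configuration
`S(θ) = Φ(0,θ) + Φ(ρ,ϑ+θ)` crosses UMKLAPP caustics `2πm + 2·FS` (for a positive-measure set of `ϑ` — 63–88 % of `(0,2π]` on klWindowC, memo §5 (b)), and just past such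
a crossing the one-sided square-root (Kohn) cusp of the bubble makes `|∂_θ𝐁| ≍ |X*|·(c₂Λ_n)^{−1/2}` with `X* ≠ 0` (the co-moving cure kills `X` on the direct sheet only);
hence `sup_θ|∂_θ𝐁(ρ,ϑ,·)| ≍ Λ_n^{−1/2}` on that set and every θ-uniform `a₁` has `∫dϑ a₁ ≳ Λ_n^{−1/2}`.  What `TwoLegReadJetBound` needs is pointwise in `θ` with the
loop integral INSIDE: `sup_{θ,ρ} ∫dϑ |∂_θ^i 𝐁(ρ,ϑ,θ)| ≤ C_i` (C4A-PLAN §24.4 EXPECTED RESULT) — the sup OUTSIDE.  The tube tadpole-jet theorem already supports this: its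
dominated-convergence dominator is the qualitative `exists_const_dom_tube` (any size), and the quantitative hypothesis is used at the target `θ` only.  This file types the
θ-pointwise twins:
* §1 **`CoMovingJetsL1Theta N a r μ K V`**, `a : ℝ → ℕ → ℝ × ℝ → ℝ` — for every base angle `θ` its own family of integrable dominators `a θ i`; accessors, `mono`, `add`,
  `const_smul`, `zero`, `sum`; `CoMovingJetsL1.toTheta` (θ-uniform dominators are a special case — the `k = 0` dominator of `…C4aAbsBubbleDominatorExists` and the
  honest-majorant pieces of `…C4aCoMovingJetsL1Sum` stay as they are);
* §2 **`norm_iteratedDeriv_tadpole_integrand_le_at`**, **`norm_iteratedDeriv_tadpole_le_at`**, **`norm_iteratedDeriv_tubeTadpole_le_at`** — the Leibniz bound, the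
  tadpole-jet theorem and its momentum-space (tube) form with the co-moving jet hypothesis AT THE TARGET θ ONLY (proofs = those of …C4aTadpoleJets / …C4aTubeTadpole);
* §3 **`norm_iteratedDeriv_tubeTadpole_le_of_L1Theta`** and the HEADLINE **`norm_iteratedDeriv_tubeTadpole_le_of_L1Theta_unif`**: under `CoMovingJetsL1Theta N a r μ K V`
  and `∀ θ, ∀ i ≤ N, ∀ ρ ∈ (−r,r), ∫_{(0,2π]} a θ i (ρ,ϑ) dϑ ≤ M_i`, for `j ≤ N` and every `θ`:
  `‖∂_θʲ ∫_{tube} f(e_K q)·V(Φ(0,θ), q) dq‖ ≤ (Σ_{i≤j} C(j,i)·G_i·M_{j−i}) · ∫_{(−r,r)} ‖f‖` — the SAME conclusion as `…_of_L1_unif`.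
The capstones (`…C4aTadpoleJetAssembly(Ref)`, `…C4aSliceIncrementAssembly`) consume the headline at each `θ`, so their sup-outside twins are one-token changes.
Pure analysis on the tree's objects; nothing is asserted about the Hubbard model; nothing asserts (C), K3 or superconductivity.
References: FST II CPAM 51 (1998) §3 Thm 3.5 [cite: FeldmanSalmhoferTrubowitz1998]; BGM 2006 §2.4 (2.36) [cite: BenfattoGiulianiMastropietro2006]; Hörmander ALPDO I Thm 1.1.9.
-/

noncomputable section

namespace Summit.HubbardSuperconductivity.HubbardSuperconductivity.Theorems.C4a

set_option linter.dupNamespace false -- summit = problem name (single-conjunct summit), D-0017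

open Real Set MeasureTheory Filter
open scoped ContDiff Topology
open Literature.Analysis.Calculus
open Literature.MathematicalPhysics.QuantumLattice Literature.MathematicalPhysics.QuantumLattice.BandSectorCounting
open Summit.HubbardSuperconductivity.HubbardSuperconductivity.Theorems.DispersionFlow
open Summit.HubbardSuperconductivity.HubbardSuperconductivity.Theorems.KLRegimeSplit
open Summit.HubbardSuperconductivity.HubbardSuperconductivity.Theorems.PerturbedFermiCurve

/-! ## §1 The θ-pointwise `L¹(dϑ)` co-moving jet invariant -/

/-- **(J-L¹-θ) `CoMovingJetsL1Theta N a r μ K V`** — INTEGRATED CO-MOVING JETS WITH BASE-ANGLE-DEPENDENT DOMINATORS: for every base angle `θ` there is a family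
`a θ i` of dominators, integrable on the chart box `(−r, r) ×ˢ (0, 2π]`, such that for all levels `|ρ| < r` and relative loop angles `ϑ` the co-moving reading
`coMoving μ K V θ ρ (ϑ + θ)` is `C^N` and its `i`-th jet at time `0` (`i ≤ N`) is `≤ a θ i (ρ, ϑ)`.  The (L3) deliverable in SUP-OUTSIDE form: `n`-free bounds are
asked of `sup_θ sup_ρ ∫dϑ a θ i (ρ,ϑ)`, never of `∫dϑ sup_θ`. -/
def CoMovingJetsL1Theta (N : ℕ) (a : ℝ → ℕ → ℝ × ℝ → ℝ) (r μ : ℝ) (K : TrigPolyC4v) (V : Momentum → Momentum → ℂ) : Prop :=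
  ∀ θ : ℝ, (∀ i ≤ N, IntegrableOn (a θ i) (Ioo (-r) r ×ˢ Ioc 0 (2 * π))) ∧
    ∀ ρ ϑ : ℝ, |ρ| < r →
      ContDiff ℝ N (coMoving μ K V θ ρ (ϑ + θ)) ∧ ∀ i ≤ N, ‖iteratedDeriv i (coMoving μ K V θ ρ (ϑ + θ)) 0‖ ≤ a θ i (ρ, ϑ)

namespace CoMovingJetsL1Theta

variable {N : ℕ} {a a' : ℝ → ℕ → ℝ × ℝ → ℝ} {r μ : ℝ} {K : TrigPolyC4v} {V V₁ V₂ : Momentum → Momentum → ℂ}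

/-- Accessor: the dominators of base angle `θ` are integrable on the chart box. -/
theorem integrableOn (h : CoMovingJetsL1Theta N a r μ K V) (θ : ℝ) {i : ℕ} (hi : i ≤ N) :
    IntegrableOn (a θ i) (Ioo (-r) r ×ˢ Ioc 0 (2 * π)) := (h θ).1 i hi

/-- Accessor: smoothness of the co-moving reading. -/
theorem contDiff (h : CoMovingJetsL1Theta N a r μ K V) (θ : ℝ) {ρ : ℝ} (hρ : |ρ| < r) (ϑ : ℝ) :
    ContDiff ℝ N (coMoving μ K V θ ρ (ϑ + θ)) := ((h θ).2 ρ ϑ hρ).1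

/-- Accessor: the pointwise domination of the `i`-th co-moving jet at base angle `θ` by `a θ i (ρ, ϑ)`. -/
theorem le (h : CoMovingJetsL1Theta N a r μ K V) (θ : ℝ) {ρ : ℝ} (hρ : |ρ| < r) (ϑ : ℝ) {i : ℕ} (hi : i ≤ N) :
    ‖iteratedDeriv i (coMoving μ K V θ ρ (ϑ + θ)) 0‖ ≤ a θ i (ρ, ϑ) := ((h θ).2 ρ ϑ hρ).2 i hi

/-- The same data packaged at ONE base angle, in the shape `norm_iteratedDeriv_tubeTadpole_le_at` consumes. -/
theorem le_at (h : CoMovingJetsL1Theta N a r μ K V) (θ : ℝ) :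
    ∀ ρ ϑ : ℝ, |ρ| < r → ∀ i ≤ N, ‖iteratedDeriv i (coMoving μ K V θ ρ (ϑ + θ)) 0‖ ≤ a θ i (ρ, ϑ) :=
  fun _ ϑ hρ _ hi => h.le θ hρ ϑ hi

/-- **Monotonicity**: larger integrable dominators. -/
theorem mono (h : CoMovingJetsL1Theta N a r μ K V) (haa' : ∀ θ, ∀ i ≤ N, ∀ p, a θ i p ≤ a' θ i p)
    (ha' : ∀ θ, ∀ i ≤ N, IntegrableOn (a' θ i) (Ioo (-r) r ×ˢ Ioc 0 (2 * π))) : CoMovingJetsL1Theta N a' r μ K V :=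
  fun θ => ⟨ha' θ, fun _ ϑ hρ => ⟨h.contDiff θ hρ ϑ, fun i hi => (h.le θ hρ ϑ hi).trans (haa' θ i hi _)⟩⟩

/-- **Additivity** (the fat vertex is a sum of channel pieces): dominators add, base angle by base angle. -/
theorem add (h₁ : CoMovingJetsL1Theta N a r μ K V₁) (h₂ : CoMovingJetsL1Theta N a' r μ K V₂) :
    CoMovingJetsL1Theta N (fun θ i p => a θ i p + a' θ i p) r μ K (fun k q => V₁ k q + V₂ k q) := by
  intro θ
  refine ⟨fun i hi => (h₁.integrableOn θ hi).add (h₂.integrableOn θ hi), fun ρ ϑ hρ => ?_⟩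
  have hsum : coMoving μ K (fun k q => V₁ k q + V₂ k q) θ ρ (ϑ + θ) =
      coMoving μ K V₁ θ ρ (ϑ + θ) + coMoving μ K V₂ θ ρ (ϑ + θ) := by
    funext t; simp [coMoving]
  refine ⟨by rw [hsum]; exact (h₁.contDiff θ hρ ϑ).add (h₂.contDiff θ hρ ϑ), fun i hi => ?_⟩
  rw [hsum, iteratedDeriv_add ((h₁.contDiff θ hρ ϑ).contDiffAt.of_le (by exact_mod_cast hi))
    ((h₂.contDiff θ hρ ϑ).contDiffAt.of_le (by exact_mod_cast hi))]
  exact (norm_add_le _ _).trans (add_le_add (h₁.le θ hρ ϑ hi) (h₂.le θ hρ ϑ hi))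

/-- **Scalar prefactors** (running couplings): `c • V` has dominators `‖c‖·a θ i`. -/
theorem const_smul (h : CoMovingJetsL1Theta N a r μ K V) (c : ℂ) :
    CoMovingJetsL1Theta N (fun θ i p => ‖c‖ * a θ i p) r μ K (fun k q => c * V k q) := by
  intro θ
  refine ⟨fun i hi => (h.integrableOn θ hi).const_mul _, fun ρ ϑ hρ => ?_⟩
  have hsm : coMoving μ K (fun k q => c * V k q) θ ρ (ϑ + θ) = fun t => c * coMoving μ K V θ ρ (ϑ + θ) t := by
    funext t; simp [coMoving]
  refine ⟨by rw [hsm]; exact contDiff_const.mul (h.contDiff θ hρ ϑ), fun i hi => ?_⟩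
  rw [hsm, iteratedDeriv_const_mul c (((h.contDiff θ hρ ϑ).contDiffAt).of_le (by exact_mod_cast hi)), norm_mul]
  exact mul_le_mul_of_nonneg_left (h.le θ hρ ϑ hi) (norm_nonneg _)

end CoMovingJetsL1Theta

/-- **θ-uniform dominators are a special case**: `CoMovingJetsL1 N a` gives `CoMovingJetsL1Theta N (fun _ => a)`. -/
theorem CoMovingJetsL1.toTheta {N : ℕ} {a : ℕ → ℝ × ℝ → ℝ} {r μ : ℝ} {K : TrigPolyC4v} {V : Momentum → Momentum → ℂ}
    (h : CoMovingJetsL1 N a r μ K V) : CoMovingJetsL1Theta N (fun _ => a) r μ K V :=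
  fun θ => ⟨fun _ hi => h.integrableOn hi, fun _ ϑ hρ => ⟨h.contDiff θ hρ ϑ, fun _ hi => h.le θ hρ ϑ hi⟩⟩

/-- The zero vertex has zero dominators. -/
theorem CoMovingJetsL1Theta.zero (N : ℕ) (r μ : ℝ) (K : TrigPolyC4v) :
    CoMovingJetsL1Theta N (fun _ _ _ => 0) r μ K (fun _ _ => 0) := by
  intro θ
  have hfin : volume (Ioo (-r) r ×ˢ Ioc 0 (2 * π)) ≠ ⊤ :=
    ((Metric.isBounded_Ioo (-r) r).prod (Metric.isBounded_Ioc 0 (2 * π))).measure_lt_top.ne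
  refine ⟨fun i _ => integrableOn_const hfin, fun ρ ϑ _ => ?_⟩
  have hco : coMoving μ K (fun _ _ => (0 : ℂ)) θ ρ (ϑ + θ) = fun _ => 0 := by funext t; simp [coMoving]
  rw [hco]
  refine ⟨contDiff_const, fun i _ => ?_⟩
  rw [iteratedDeriv_const]; simp

/-- **Finite additivity**: a finite sum of vertices with `CoMovingJetsL1Theta` dominators has the sum of the dominators. -/
theorem CoMovingJetsL1Theta.sum {ι : Type*} (s : Finset ι) {N : ℕ} {r μ : ℝ} {K : TrigPolyC4v} {a : ι → ℝ → ℕ → ℝ × ℝ → ℝ}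
    {V : ι → Momentum → Momentum → ℂ} (h : ∀ c ∈ s, CoMovingJetsL1Theta N (a c) r μ K (V c)) :
    CoMovingJetsL1Theta N (fun θ i p => ∑ c ∈ s, a c θ i p) r μ K (fun k q => ∑ c ∈ s, V c k q) := by
  classical
  induction s using Finset.induction_on with
  | empty => simpa using CoMovingJetsL1Theta.zero N r μ K
  | insert c s hc ih =>
    have h1 : CoMovingJetsL1Theta N (a c) r μ K (V c) := h c (Finset.mem_insert_self c s)
    have h2 := ih fun c' hc' => h c' (Finset.mem_insert_of_mem hc')
    have h3 := h1.add h2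
    simp only [Finset.sum_insert hc]
    exact h3

/-! ## §2 The tadpole-jet theorem with the co-moving hypothesis at the target base angle only -/

section Tadpole

variable {a b : ℝ} (B : BandBounds a b) {K : TrigPolyC4v} {A : ℝ}
  (hA : ∀ p : Momentum, ∀ j ≤ 2, ‖iteratedFDeriv ℝ j (frameShift K) p‖ ≤ A) (hADt : 2 * A < B.Dtmin)
  {μ r : ℝ} (hr : 0 < r) (hlo : a < μ - r - A) (hhi : μ + r + A < b)
include B hA hADt hr hlo hhi

/-- **Leibniz bound for the co-moving integrand at a level inside the tube, base angle `θ`** — the hypothesis on the kernel's co-moving jets is asked at the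
base angles `(θ, ϑ + θ)` of THIS `θ` only: `‖∂_θʲ [f(ρ) · W(ρ, ϑ+θ) • coMoving μ K V_ρ 0 ρ ϑ θ]‖ ≤ ‖f ρ‖ · Σ_{i ≤ j} C(j,i) G_i a_{j−i}(ρ, ϑ)`. -/
theorem norm_iteratedDeriv_tadpole_integrand_le_at (f : ℝ → ℂ)
    {W : ℝ × ℝ → ℝ} (hW : ContDiffOn ℝ ∞ W ({ρ : ℝ | |ρ| < r} ×ˢ univ))
    {N : ℕ} {G : ℕ → ℝ} (hWjet : ∀ ρ, |ρ| < r → ∀ i ≤ N, ∀ s, ‖iteratedDeriv i (fun s => W (ρ, s)) s‖ ≤ G i)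
    {V : ℝ → Momentum → Momentum → ℂ} (hV : ContDiff ℝ ∞ fun x : ℝ × Momentum × Momentum => V x.1 x.2.1 x.2.2)
    (θ : ℝ) {aV : ℕ → ℝ × ℝ → ℝ}
    (hVjet : ∀ ρ ϑ, |ρ| < r → ∀ i ≤ N, ‖iteratedDeriv i (coMoving μ K (V ρ) θ ρ (ϑ + θ)) 0‖ ≤ aV i (ρ, ϑ))
    {ρ : ℝ} (hρ : |ρ| < r) (ϑ : ℝ) {j : ℕ} (hj : j ≤ N) :
    ‖iteratedDeriv j (fun θ : ℝ => f ρ * (W (ρ, ϑ + θ) • coMoving μ K (V ρ) 0 ρ ϑ θ)) θ‖ ≤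
      ‖f ρ‖ * ∑ i ∈ Finset.range (j + 1), (j.choose i : ℝ) * G i * aV (j - i) (ρ, ϑ) := by
  -- smoothness of the two `θ`-dependent factors
  have hWθ : ContDiff ℝ ∞ (fun θ : ℝ => W (ρ, ϑ + θ)) := by
    have hmap : ∀ t : ℝ, ((ρ : ℝ), ϑ + t) ∈ ({ρ : ℝ | |ρ| < r} ×ˢ (univ : Set ℝ)) := fun t => ⟨hρ, mem_univ _⟩
    exact hW.comp_contDiff (contDiff_const.prodMk (contDiff_const.add contDiff_id)) hmap
  have hCo : ContDiff ℝ ∞ (coMoving μ K (V ρ) 0 ρ ϑ) := contDiff_coMoving B hA hADt hr hlo hhi hV hρ 0 ϑ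
  have hprod : ContDiff ℝ ∞ (fun θ : ℝ => W (ρ, ϑ + θ) • coMoving μ K (V ρ) 0 ρ ϑ θ) := hWθ.smul hCo
  -- pull the constant slice factor out
  rw [iteratedDeriv_const_mul (f ρ) (hprod.contDiffAt.of_le (by exact_mod_cast le_top)), norm_mul]
  refine mul_le_mul_of_nonneg_left ?_ (norm_nonneg _)
  -- Leibniz
  have hjN : (j : ℕ∞ω) ≤ ∞ := by exact_mod_cast le_top
  have hL := norm_iteratedFDeriv_smul_le hWθ hCo θ (n := j) hjN
  rw [norm_iteratedFDeriv_eq_norm_iteratedDeriv] at hL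
  refine hL.trans (Finset.sum_le_sum fun i hi => ?_)
  have hij : i ≤ j := Nat.lt_succ_iff.mp (Finset.mem_range.mp hi)
  -- the weight factor
  have h1 : ‖iteratedFDeriv ℝ i (fun θ : ℝ => W (ρ, ϑ + θ)) θ‖ ≤ G i := by
    rw [norm_iteratedFDeriv_eq_norm_iteratedDeriv]
    have key := congrFun (iteratedDeriv_comp_const_add i (fun s : ℝ => W (ρ, s)) ϑ) θ
    rw [key]
    exact hWjet ρ hρ i (hij.trans hj) (ϑ + θ)
  -- the kernel factor, through the shift identity — the hypothesis is used at the target `θ` only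
  have h2 : ‖iteratedFDeriv ℝ (j - i) (coMoving μ K (V ρ) 0 ρ ϑ) θ‖ ≤ aV (j - i) (ρ, ϑ) := by
    rw [norm_iteratedFDeriv_eq_norm_iteratedDeriv, iteratedDeriv_coMoving_base_zero]
    exact hVjet ρ ϑ hρ (j - i) ((Nat.sub_le j i).trans hj)
  have hG : 0 ≤ G i := (norm_nonneg _).trans h1
  have hC : (0 : ℝ) ≤ (j.choose i : ℝ) := Nat.cast_nonneg _
  calc (j.choose i : ℝ) * ‖iteratedFDeriv ℝ i (fun θ : ℝ => W (ρ, ϑ + θ)) θ‖ *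
        ‖iteratedFDeriv ℝ (j - i) (coMoving μ K (V ρ) 0 ρ ϑ) θ‖
      ≤ (j.choose i : ℝ) * G i * aV (j - i) (ρ, ϑ) :=
        mul_le_mul (mul_le_mul_of_nonneg_left h1 hC) h2 (norm_nonneg _) (mul_nonneg hC hG)

/-- **THE TADPOLE-JET THEOREM AT ONE BASE ANGLE (dominators of that angle).**  Same objects as `…C4aTadpoleJets.norm_iteratedDeriv_tadpole_le`; the co-moving jet
hypothesis `‖∂ₜⁱ coMoving μ K V_ρ θ ρ (ϑ + θ)|₀‖ ≤ a_i(ρ, ϑ)` is asked at the TARGET base angle `θ` only (the dominators `a_i` may be chosen per `θ`), with `a_i`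
integrable on the tube.  Then for `j ≤ N`: `‖∂_θʲ ∫_{(−r,r)×(0,2π]} f(ρ)·W(ρ,ϑ)•V_ρ(Φ(0,θ),Φ(ρ,ϑ))‖ ≤ Σ_{i ≤ j} C(j,i)·G_i·∫_{tube} ‖f(ρ)‖·a_{j−i}(ρ,ϑ)` at that `θ`.
(Differentiation under the integral uses the qualitative constant dominators of `exists_const_dom_tube`, not the `a_i`.) -/
theorem norm_iteratedDeriv_tadpole_le_at {f : ℝ → ℂ} (hf : ContDiff ℝ ∞ f) (hfsupp : tsupport f ⊆ Ioo (-r) r)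
    {W : ℝ × ℝ → ℝ} (hW : ContDiffOn ℝ ∞ W ({ρ : ℝ | |ρ| < r} ×ˢ univ))
    (hWper : ∀ ρ, Function.Periodic (fun ϑ => W (ρ, ϑ)) (2 * π))
    {N : ℕ} {G : ℕ → ℝ} (hWjet : ∀ ρ, |ρ| < r → ∀ i ≤ N, ∀ s, ‖iteratedDeriv i (fun s => W (ρ, s)) s‖ ≤ G i)
    {V : ℝ → Momentum → Momentum → ℂ} (hV : ContDiff ℝ ∞ fun x : ℝ × Momentum × Momentum => V x.1 x.2.1 x.2.2)
    (θ : ℝ) {aV : ℕ → ℝ × ℝ → ℝ} (haV : ∀ i ≤ N, IntegrableOn (aV i) (Ioo (-r) r ×ˢ Ioc 0 (2 * π)))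
    (hVjet : ∀ ρ ϑ, |ρ| < r → ∀ i ≤ N, ‖iteratedDeriv i (coMoving μ K (V ρ) θ ρ (ϑ + θ)) 0‖ ≤ aV i (ρ, ϑ))
    {Ψ : ℝ × (ℝ × ℝ) → ℂ}
    (hΨ : Ψ = fun p => f p.2.1 * (W p.2 • V p.2.1 (levelPoint μ K 0 p.1) (levelPoint μ K p.2.1 p.2.2)))
    {j : ℕ} (hj : j ≤ N) :
    ‖iteratedDeriv j (fun θ : ℝ => ∫ a in Ioo (-r) r ×ˢ Ioc 0 (2 * π), Ψ (θ, a)) θ‖ ≤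
      ∑ i ∈ Finset.range (j + 1), (j.choose i : ℝ) * G i *
        ∫ a in Ioo (-r) r ×ˢ Ioc 0 (2 * π), ‖f a.1‖ * aV (j - i) a := by
  set S : Set (ℝ × ℝ) := Ioo (-r) r ×ˢ Ioc 0 (2 * π) with hS
  have hΨs : ContDiff ℝ ∞ Ψ := contDiff_tadpoleIntegrand B hA hADt hr hlo hhi hf hfsupp hW hV hΨ
  have hperϑ := tadpoleIntegrand_periodic_loop (μ := μ) (K := K) hWper hΨ
  have hperθ := tadpoleIntegrand_periodic_ext (μ := μ) (K := K) hΨ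
  have hzero := tadpoleIntegrand_eq_zero_of_le (μ := μ) (K := K) hfsupp hΨ
  -- finite measure of the tube (for the constant dominators)
  have hSfin : volume S ≠ ⊤ :=
    ((Metric.isBounded_Ioo (-r) r).prod (Metric.isBounded_Ioc 0 (2 * π))).measure_lt_top.ne
  have hdom : ∀ m : ℕ, ∃ g : ℝ × ℝ → ℝ, IntegrableOn g S ∧
      ∀ a θ, ‖iteratedDeriv m (fun θ : ℝ => Ψ (θ, (a.1, a.2 + θ))) θ‖ ≤ g a := by
    intro m
    obtain ⟨C, -, hC⟩ := exists_const_dom_tube hΨs two_pi_pos hperθ hperϑ hzero m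
    exact ⟨fun _ => C, integrableOn_const hSfin, hC⟩
  -- a bound on the slice profile
  have hfcpt : HasCompactSupport f :=
    IsCompact.of_isClosed_subset isCompact_Icc (isClosed_tsupport f) (hfsupp.trans Ioo_subset_Icc_self)
  obtain ⟨Cf, hCf⟩ := hf.continuous.bounded_above_of_compact_support hfcpt
  -- the quantitative dominator of order j (at this θ)
  set g : ℝ × ℝ → ℝ := fun a => ‖f a.1‖ * ∑ i ∈ Finset.range (j + 1), (j.choose i : ℝ) * G i * aV (j - i) a with hg
  have hsumInt : IntegrableOn (fun a => ∑ i ∈ Finset.range (j + 1), (j.choose i : ℝ) * G i * aV (j - i) a) S := by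
    refine integrable_finsetSum _ fun i hi => ?_
    exact (haV (j - i) ((Nat.sub_le j i).trans hj)).const_mul _
  have hfmeas : AEStronglyMeasurable (fun a : ℝ × ℝ => ‖f a.1‖) (volume.restrict S) :=
    (continuous_norm.comp (hf.continuous.comp continuous_fst)).aestronglyMeasurable
  have hfbd : ∀ᵐ a ∂(volume.restrict S), ‖(fun a : ℝ × ℝ => ‖f a.1‖) a‖ ≤ Cf :=
    Eventually.of_forall fun a => by simp only [norm_norm]; exact hCf a.1
  have hgInt : IntegrableOn g S := hsumInt.bdd_mul hfmeas hfbd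
  -- the pointwise bound at this θ
  have hb : ∀ a : ℝ × ℝ, ‖iteratedDeriv j (fun θ : ℝ => Ψ (θ, (a.1, a.2 + θ))) θ‖ ≤ g a := by
    intro a
    by_cases ha : |a.1| < r
    · have key := norm_iteratedDeriv_tadpole_integrand_le_at B hA hADt hr hlo hhi f hW hWjet hV θ hVjet ha a.2 hj
      have hfun : (fun θ : ℝ => Ψ (θ, (a.1, a.2 + θ))) =
          fun θ => f a.1 * (W (a.1, a.2 + θ) • coMoving μ K (V a.1) 0 a.1 a.2 θ) := by
        funext θ'
        simp only [hΨ, coMoving, zero_add]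
      rw [hfun]
      exact key
    · have hz : (fun θ : ℝ => Ψ (θ, (a.1, a.2 + θ))) = fun _ => (0 : ℂ) :=
        funext fun θ' => hzero θ' a.1 _ (not_lt.mp ha)
      have hρ' : a.1 ∉ tsupport f := fun h => ha (by have h' := hfsupp h; exact abs_lt.2 ⟨h'.1, h'.2⟩)
      have hf0 : f a.1 = 0 := image_eq_zero_of_notMem_tsupport hρ'
      rw [hz, iteratedDeriv_const]
      simp [hg, hf0]
  have hmain := norm_iteratedDeriv_tube_integral_le hΨs two_pi_pos hperϑ hdom (n := j) (θ := θ) hgInt hb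
  refine hmain.trans (le_of_eq ?_)
  -- ∫ g = Σ_i C(j,i) G_i ∫ ‖f‖ a_{j-i}
  have hgeq : g = fun a => ∑ i ∈ Finset.range (j + 1), ((j.choose i : ℝ) * G i) * (‖f a.1‖ * aV (j - i) a) := by
    funext a
    simp only [hg]
    rw [Finset.mul_sum]
    exact Finset.sum_congr rfl fun i _ => by ring
  have hterm : ∀ i ∈ Finset.range (j + 1),
      Integrable (fun a : ℝ × ℝ => ((j.choose i : ℝ) * G i) * (‖f a.1‖ * aV (j - i) a)) (volume.restrict S) := by
    intro i hi
    have hij : j - i ≤ N := (Nat.sub_le j i).trans hj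
    exact ((haV (j - i) hij).bdd_mul hfmeas hfbd).const_mul _
  rw [hgeq, integral_finsetSum _ hterm]
  refine Finset.sum_congr rfl fun i _ => ?_
  rw [integral_const_mul]

/-- **The tube tadpole-jet theorem at one base angle** (momentum-space form of `norm_iteratedDeriv_tadpole_le_at`; weight = the Jacobian `levelChartJac`). -/
theorem norm_iteratedDeriv_tubeTadpole_le_at {f : ℝ → ℂ} (hf : ContDiff ℝ ∞ f) (hfsupp : tsupport f ⊆ Ioo (-r) r)
    {N : ℕ} {G : ℕ → ℝ} (hJjet : ∀ ρ, |ρ| < r → ∀ i ≤ N, ∀ s, ‖iteratedDeriv i (fun s => levelChartJac μ K (ρ, s)) s‖ ≤ G i)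
    {V : Momentum → Momentum → ℂ} (hV : ContDiff ℝ ∞ fun x : Momentum × Momentum => V x.1 x.2)
    (θ : ℝ) {aV : ℕ → ℝ × ℝ → ℝ} (haV : ∀ i ≤ N, IntegrableOn (aV i) (Ioo (-r) r ×ˢ Ioc 0 (2 * π)))
    (hVjet : ∀ ρ ϑ, |ρ| < r → ∀ i ≤ N, ‖iteratedDeriv i (coMoving μ K V θ ρ (ϑ + θ)) 0‖ ≤ aV i (ρ, ϑ))
    {j : ℕ} (hj : j ≤ N) :
    ‖iteratedDeriv j (fun θ : ℝ =>
        ∫ q in {q : ℝ × ℝ | |q.1| < π ∧ |q.2| < π ∧ |frameLevel μ K (WithLp.toLp 2 ![q.1, q.2])| < r},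
          f (frameLevel μ K (WithLp.toLp 2 ![q.1, q.2])) * V (levelPoint μ K 0 θ) (WithLp.toLp 2 ![q.1, q.2])) θ‖ ≤
      ∑ i ∈ Finset.range (j + 1), (j.choose i : ℝ) * G i *
        ∫ a in Ioo (-r) r ×ˢ Ioc 0 (2 * π), ‖f a.1‖ * aV (j - i) a := by
  have hfun : (fun θ : ℝ =>
        ∫ q in {q : ℝ × ℝ | |q.1| < π ∧ |q.2| < π ∧ |frameLevel μ K (WithLp.toLp 2 ![q.1, q.2])| < r},
          f (frameLevel μ K (WithLp.toLp 2 ![q.1, q.2])) * V (levelPoint μ K 0 θ) (WithLp.toLp 2 ![q.1, q.2])) =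
      fun θ : ℝ => ∫ a in Ioo (-r) r ×ˢ Ioc 0 (2 * π),
        (fun p : ℝ × (ℝ × ℝ) => f p.2.1 * (levelChartJac μ K p.2 • (fun (_ : ℝ) (k q : Momentum) => V k q) p.2.1
          (levelPoint μ K 0 p.1) (levelPoint μ K p.2.1 p.2.2))) (θ, a) :=
    funext fun θ' => tubeTadpole_eq_chart B hA hADt hlo hhi hf hfsupp hV θ'
  rw [hfun]
  have hV' : ContDiff ℝ ∞ fun x : ℝ × Momentum × Momentum => (fun (_ : ℝ) (k q : Momentum) => V k q) x.1 x.2.1 x.2.2 :=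
    hV.comp contDiff_snd
  exact norm_iteratedDeriv_tadpole_le_at B hA hADt hr hlo hhi hf hfsupp (contDiffOn_levelChartJac B hA hADt hlo hhi)
    (levelChartJac_periodic μ K) hJjet (V := fun (_ : ℝ) (k q : Momentum) => V k q) hV' θ haV
    (fun ρ ϑ hρ i hi => hVjet ρ ϑ hρ i hi) rfl hj

/-! ## §3 The headline keyed by `CoMovingJetsL1Theta` -/

/-- **The tube tadpole-jet theorem, (J-L¹-θ) form.** -/
theorem norm_iteratedDeriv_tubeTadpole_le_of_L1Theta {f : ℝ → ℂ} (hf : ContDiff ℝ ∞ f) (hfsupp : tsupport f ⊆ Ioo (-r) r)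
    {N : ℕ} {G : ℕ → ℝ} (hJjet : ∀ ρ, |ρ| < r → ∀ i ≤ N, ∀ s, ‖iteratedDeriv i (fun s => levelChartJac μ K (ρ, s)) s‖ ≤ G i)
    {V : Momentum → Momentum → ℂ} (hV : ContDiff ℝ ∞ fun x : Momentum × Momentum => V x.1 x.2)
    {aV : ℝ → ℕ → ℝ × ℝ → ℝ} (hVJ : CoMovingJetsL1Theta N aV r μ K V) {j : ℕ} (hj : j ≤ N) (θ : ℝ) :
    ‖iteratedDeriv j (fun θ : ℝ =>
        ∫ q in {q : ℝ × ℝ | |q.1| < π ∧ |q.2| < π ∧ |frameLevel μ K (WithLp.toLp 2 ![q.1, q.2])| < r},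
          f (frameLevel μ K (WithLp.toLp 2 ![q.1, q.2])) * V (levelPoint μ K 0 θ) (WithLp.toLp 2 ![q.1, q.2])) θ‖ ≤
      ∑ i ∈ Finset.range (j + 1), (j.choose i : ℝ) * G i *
        ∫ p in Ioo (-r) r ×ˢ Ioc 0 (2 * π), ‖f p.1‖ * aV θ (j - i) p :=
  norm_iteratedDeriv_tubeTadpole_le_at B hA hADt hr hlo hhi hf hfsupp hJjet hV θ (fun _ hi => hVJ.integrableOn θ hi) (hVJ.le_at θ) hj

/-- **HEADLINE FORM, SUP OUTSIDE: jet constants × uniform `L¹(dϑ)` co-moving norms × slice mass.**  If `∫_{(0,2π]} a θ i (ρ,ϑ) dϑ ≤ M_i` for every base angle `θ`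
and every level `ρ ∈ (−r, r)` (`i ≤ N`), then for `j ≤ N` and every `θ`:
`‖∂_θʲ ∫_{tube} f(e_K q)·V(Φ(0,θ), q) dq‖ ≤ (Σ_{i≤j} C(j,i)·G_i·M_{j−i}) · ∫_{(−r,r)} ‖f‖` — the conclusion of `…_of_L1_unif`, from θ-dependent dominators. -/
theorem norm_iteratedDeriv_tubeTadpole_le_of_L1Theta_unif {f : ℝ → ℂ} (hf : ContDiff ℝ ∞ f) (hfsupp : tsupport f ⊆ Ioo (-r) r)
    {N : ℕ} {G : ℕ → ℝ} (hJjet : ∀ ρ, |ρ| < r → ∀ i ≤ N, ∀ s, ‖iteratedDeriv i (fun s => levelChartJac μ K (ρ, s)) s‖ ≤ G i)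
    {V : Momentum → Momentum → ℂ} (hV : ContDiff ℝ ∞ fun x : Momentum × Momentum => V x.1 x.2)
    {aV : ℝ → ℕ → ℝ × ℝ → ℝ} (hVJ : CoMovingJetsL1Theta N aV r μ K V)
    {M : ℕ → ℝ} (hM : ∀ θ, ∀ i ≤ N, ∀ ρ ∈ Ioo (-r) r, ∫ ϑ in Ioc 0 (2 * π), aV θ i (ρ, ϑ) ≤ M i) {j : ℕ} (hj : j ≤ N) (θ : ℝ) :
    ‖iteratedDeriv j (fun θ : ℝ =>
        ∫ q in {q : ℝ × ℝ | |q.1| < π ∧ |q.2| < π ∧ |frameLevel μ K (WithLp.toLp 2 ![q.1, q.2])| < r},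
          f (frameLevel μ K (WithLp.toLp 2 ![q.1, q.2])) * V (levelPoint μ K 0 θ) (WithLp.toLp 2 ![q.1, q.2])) θ‖ ≤
      (∑ i ∈ Finset.range (j + 1), (j.choose i : ℝ) * G i * M (j - i)) * ∫ ρ in Ioo (-r) r, ‖f ρ‖ := by
  refine (norm_iteratedDeriv_tubeTadpole_le_of_L1Theta B hA hADt hr hlo hhi hf hfsupp hJjet hV hVJ hj θ).trans ?_
  rw [Finset.sum_mul]
  refine Finset.sum_le_sum fun i hi => ?_
  have hij : j - i ≤ N := (Nat.sub_le j i).trans hj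
  have hI := setIntegral_box_norm_mul_le_of_unif hf.continuous (hVJ.integrableOn θ hij) (hM θ (j - i) hij)
  have hG : 0 ≤ G i := by
    have h0 := hJjet 0 (by simpa using hr) i (Nat.lt_succ_iff.mp (Finset.mem_range.mp hi) |>.trans hj) 0
    exact (norm_nonneg _).trans h0
  have hC : (0 : ℝ) ≤ (j.choose i : ℝ) * G i := mul_nonneg (Nat.cast_nonneg _) hG
  calc (j.choose i : ℝ) * G i * ∫ p in Ioo (-r) r ×ˢ Ioc 0 (2 * π), ‖f p.1‖ * aV θ (j - i) p
      ≤ (j.choose i : ℝ) * G i * (M (j - i) * ∫ ρ in Ioo (-r) r, ‖f ρ‖) := mul_le_mul_of_nonneg_left hI hC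
    _ = (j.choose i : ℝ) * G i * M (j - i) * ∫ ρ in Ioo (-r) r, ‖f ρ‖ := by ring

end Tadpole

end Summit.HubbardSuperconductivity.HubbardSuperconductivity.Theorems.C4a

end
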